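import Literature.IUT.HodgeTheaters.PuncturedEllipticCoveringsCusps
import Literature.IUT.HodgeTheaters.InitialThetaData
import HarnessLib

/-!
# GAP G-L5t4g3-3 (L5-lead shape 06:21:10Z): Galois/automorphism-stability of the cuspidal decomposition classes of `X̲_K`
# under the FULL normaliser `N_{Π_{C_F}}(Π_{X̲_K})`, and the DERIVED cusp action `actF` of `Aut(𝒟^{⊚±})`-representatives
# (interface law + derived defs — post-freeze additive D13, not a cone member; NOT a new fact)

S. Mochizuki, *Inter-universal Teichmüller theory I*, kurims manuscript (May 2020), Def 6.1 (v) p. 158 («`Aut(𝒟^{⊚±}) ≅ Aut(X̲_K)`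
… the cusps of `X̲_K`»; «`Aut_csp ⊆ Aut_±` … fix the cusps»), Def 6.1 (vi) p. 159 (`LabCusp^±(†𝒟^{⊚±})` functorial in
isomorphisms); the anabelian input — cuspidal decomposition groups are group-theoretically characteristic, hence permuted by every
automorphism — is [AbsTopI] Lem. 4.5 / [AbsTopIII] Thm. 1.9, consumed by name elsewhere ([IUTchI] Def 6.1 (v) p.158)
[claim: Mochizuki2012, status: disputed] (D-0012 claim key, series status DISPUTED — an interface LAW over abc-iut-L5-t2's REAL
`InitialThetaData` and abc-iut-L5-t1's `CuspGalois` (p424023), stated as a one-field `structure … : Prop` (the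
interface-claims pattern of t1's `ArrowCoveringClaims`: a HYPOTHESIS binder for consumers, never asserted), plus definitions derived from it; nothing of the series is asserted, no side is taken on [IUTchIII] Cor. 3.12).

WHY (GAP-LEDGER G-L5t4g3-3, abc-iut-L5-t4 05:46Z).  The kit slots `GLab`/`gLabMap` of the P5-binding must be defined on ALL of
`Aut(𝒟^{⊚±}) = N_{Π_{C_F}}(Π_{X̲_K})/Π_{X̲_K}` (`PiAvatarOrbitCategoryAut`), which contains elements over `G_F ∖ G_K` on which t1's
K-level `CG.act` (domain `Π_{C_K}`) is silent.  WHAT IS BUILT: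
* (i) `InitialThetaData.CuspClassesNormaliserStable D : Prop` — for `n ∈ N(Π_{X̲_K})` and every cusp `x`, `n·D_x·n⁻¹` is
  `Π_{X̲_K}`-conjugate to some `D_y` (decomposition groups read in `Π_{C_F}` through `embK`);
* `eq_of_conj_embK` — t1's `CG.eq_of_conj` pushed along the injective `embK`: distinct cusps have non-`Π_{X̲_K}`-conjugate classes,
  so the `y` in (i) is UNIQUE (`actFun_unique`);
* (ii) the DERIVED action **`InitialThetaData.actF : ↥N(Π_{X̲_K}) →* Equiv.Perm Cusp(X̲_K)`** (`actFun_one`, `actFun_mul` from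
  uniqueness — w5-d228's P1 pattern), with laws (a) **`actF_decomp`**, (b) **`actF_embK : actF ⟨embK c, _⟩ = CG.act c`** (extends t1's
  action; from `CG.act_decomp`), (c) `actF_eq_one_of_mem_PiXund` (kills `Π_{X̲_K}`, so `actF` IS an action of `Aut(𝒟^{⊚±})`).
(iii) No toy NV here: t1's dihedral toy (p425511) is `PuncturedEllipticData`-level; an `InitialThetaData`-level toy is not cheap.
No instance/notation declared; typed ≠ proved elsewhere.
-/

noncomputable section

namespace Literature.IUT.HodgeTheaters

open scoped Pointwise

universe u v w

section CuspNormaliserLaw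

variable {F : Type u} {K : Type v} {Fbar : Type w} [Field F] [NumberField F] [Field K] [NumberField K]
  [Algebra F K] [Field Fbar] [Algebra F Fbar] [Algebra K Fbar]
  {E : WeierstrassCurve F} [E.IsElliptic] {l : ℕ} {Pb : BadPlacePredicates K}
  (D : InitialThetaData F K Fbar E l Pb)

namespace InitialThetaData

/-! ### (i) The interface law -/

/-- **G-L5t4g3-3 (i): stability of the cuspidal decomposition classes under the full normaliser.**  For every
`n ∈ N_{Π_{C_F}}(Π_{X̲_K})` and every cusp `x` of `X̲_K` there are a cusp `y` and `t ∈ Π_{X̲_K}` with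
`(t n)·embK(D_x)·(t n)⁻¹ = embK(D_y)` — the SET of `Π_{X̲_K}`-conjugacy classes of cuspidal decomposition groups is permuted by
every automorphism of `𝒟^{⊚±}` ([IUTchI] Def 6.1 (v)(vi); anabelian input [AbsTopI] Lem 4.5).  A `Prop` (hypothesis binder for
consumers, in the INTERFACE-CLAIMS pattern of abc-iut-L5-t1's `ArrowCoveringClaims` — a one-field `structure … : Prop`),
never asserted. ([IUTchI] Def 6.1 (v) p.158) [claim: Mochizuki2012, status: disputed] -/
structure CuspClassesNormaliserStable : Prop where
  /-- for `n ∈ N(Π_{X̲_K})` and a cusp `x`: `(t n)·embK(D_x)·(t n)⁻¹ = embK(D_y)` for some cusp `y` and `t ∈ Π_{X̲_K}` -/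
  exists_conj : ∀ n ∈ Subgroup.normalizer ((D.PiXund : Subgroup D.PiC) : Set D.PiC), ∀ x : D.geom.pe.Cusp,
    ∃ y : D.geom.pe.Cusp, ∃ t ∈ D.PiXund,
      MulAut.conj (t * n) • ((D.geom.pe.decomp x).map D.geom.embK) = (D.geom.pe.decomp y).map D.geom.embK

/-! ### Conjugation commutes with `embK`; uniqueness of the target cusp -/

/-- `embK(g)·embK(S)·embK(g)⁻¹ = embK(g·S·g⁻¹)`. ([IUTchI] Def 3.1 (d) p.62) [claim: Mochizuki2012, status: disputed] -/
theorem conj_embK_smul_map (g : D.geom.pe.PiC) (S : Subgroup D.geom.pe.PiC) :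
    MulAut.conj (D.geom.embK g) • S.map D.geom.embK = (MulAut.conj g • S).map D.geom.embK := by
  rw [Subgroup.pointwise_smul_def, Subgroup.pointwise_smul_def, Subgroup.map_map, Subgroup.map_map]
  congr 1
  ext s
  simp only [MonoidHom.comp_apply, MulDistribMulAction.toMonoidEnd_apply, MulDistribMulAction.toMonoidHom_apply,
    MulAut.smul_def, MulAut.conj_apply, map_mul, map_inv]

variable (CG : D.geom.pe.CuspGalois)

include CG in
/-- **Uniqueness**: distinct cusps of `X̲_K` have non-`Π_{X̲_K}`-conjugate decomposition classes in `Π_{C_F}` (t1's `CG.eq_of_conj`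
pushed along the injective `embK`). ([IUTchI] §1 p.37) [claim: Mochizuki2012, status: disputed] -/
theorem eq_of_conj_embK (x y : D.geom.pe.Cusp) {t : D.PiC} (ht : t ∈ D.PiXund)
    (h : MulAut.conj t • (D.geom.pe.decomp x).map D.geom.embK = (D.geom.pe.decomp y).map D.geom.embK) : x = y := by
  obtain ⟨t', ht', rfl⟩ := Subgroup.mem_map.mp ht
  rw [conj_embK_smul_map] at h
  exact CG.eq_of_conj x y t' ht' (Subgroup.map_injective D.geom.embK_injective h)

/-! ### (ii) The derived action `actF` -/

variable (hS : D.CuspClassesNormaliserStable)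

/-- The cusp `n·x` (chosen by the law (i); unique by `actFun_unique`). ([IUTchI] Def 6.1 (v) p.158) [claim: Mochizuki2012, status: disputed] -/
def actFun (n : ↥(Subgroup.normalizer ((D.PiXund : Subgroup D.PiC) : Set D.PiC))) (x : D.geom.pe.Cusp) : D.geom.pe.Cusp :=
  (hS.exists_conj n n.2 x).choose

/-- The defining property of `actFun`. ([IUTchI] Def 6.1 (v) p.158) [claim: Mochizuki2012, status: disputed] -/
theorem actFun_spec (n : ↥(Subgroup.normalizer ((D.PiXund : Subgroup D.PiC) : Set D.PiC))) (x : D.geom.pe.Cusp) :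
    ∃ t ∈ D.PiXund, MulAut.conj (t * (n : D.PiC)) • ((D.geom.pe.decomp x).map D.geom.embK) =
      (D.geom.pe.decomp (D.actFun hS n x)).map D.geom.embK :=
  (hS.exists_conj n n.2 x).choose_spec

include CG in
/-- **Uniqueness of `n·x`**: any cusp whose class is `(t n)·[D_x]` for some `t ∈ Π_{X̲_K}` IS `actFun n x`.
([IUTchI] Def 6.1 (v) p.158) [claim: Mochizuki2012, status: disputed] -/
theorem actFun_unique (n : ↥(Subgroup.normalizer ((D.PiXund : Subgroup D.PiC) : Set D.PiC))) (x y : D.geom.pe.Cusp)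
    {t : D.PiC} (ht : t ∈ D.PiXund)
    (h : MulAut.conj (t * (n : D.PiC)) • ((D.geom.pe.decomp x).map D.geom.embK) = (D.geom.pe.decomp y).map D.geom.embK) :
    D.actFun hS n x = y := by
  obtain ⟨t₁, ht₁, h₁⟩ := D.actFun_spec hS n x
  -- `D_y = (t n)(t₁ n)⁻¹ · D_{actFun n x}` with `(t n)(t₁ n)⁻¹ = t t₁⁻¹ ∈ Π_{X̲_K}`
  refine D.eq_of_conj_embK CG _ _ (D.PiXund.mul_mem ht (D.PiXund.inv_mem ht₁)) ?_
  rw [← h, ← h₁, ← mul_smul, ← map_mul]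
  congr 2
  group

include CG in
/-- `1·x = x`. ([IUTchI] Def 6.1 (v) p.158) [claim: Mochizuki2012, status: disputed] -/
theorem actFun_one (x : D.geom.pe.Cusp) : D.actFun hS 1 x = x :=
  D.actFun_unique CG hS 1 x x D.PiXund.one_mem (by simp)

include CG in
/-- `(n m)·x = n·(m·x)` (the conjugators compose inside `Π_{X̲_K}` because `n` normalises it).
([IUTchI] Def 6.1 (v) p.158) [claim: Mochizuki2012, status: disputed] -/
theorem actFun_mul (n m : ↥(Subgroup.normalizer ((D.PiXund : Subgroup D.PiC) : Set D.PiC))) (x : D.geom.pe.Cusp) :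
    D.actFun hS (n * m) x = D.actFun hS n (D.actFun hS m x) := by
  obtain ⟨tm, htm, hm⟩ := D.actFun_spec hS m x
  obtain ⟨tn, htn, hn⟩ := D.actFun_spec hS n (D.actFun hS m x)
  -- `tn n tm m = (tn (n tm n⁻¹)) (n m)` with `n tm n⁻¹ ∈ Π_{X̲_K}`
  have hconj : (n : D.PiC) * tm * (n : D.PiC)⁻¹ ∈ D.PiXund := (Subgroup.mem_normalizer_iff.mp n.2 tm).mp htm
  refine D.actFun_unique CG hS (n * m) x _ (D.PiXund.mul_mem htn hconj) ?_
  rw [← hn, ← hm, ← mul_smul, ← map_mul, Subgroup.coe_mul]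
  congr 2
  group

/-- The permutation `x ↦ n·x` (inverse `x ↦ n⁻¹·x`). ([IUTchI] Def 6.1 (v) p.158) [claim: Mochizuki2012, status: disputed] -/
def actPerm (n : ↥(Subgroup.normalizer ((D.PiXund : Subgroup D.PiC) : Set D.PiC))) : Equiv.Perm D.geom.pe.Cusp where
  toFun := D.actFun hS n
  invFun := D.actFun hS n⁻¹
  left_inv x := by rw [← D.actFun_mul CG hS, inv_mul_cancel, D.actFun_one CG hS]
  right_inv x := by rw [← D.actFun_mul CG hS, mul_inv_cancel, D.actFun_one CG hS]

/-- `actPerm n x = actFun n x`. ([IUTchI] Def 6.1 (v) p.158) [claim: Mochizuki2012, status: disputed] -/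
@[simp] theorem actPerm_apply (n : ↥(Subgroup.normalizer ((D.PiXund : Subgroup D.PiC) : Set D.PiC))) (x : D.geom.pe.Cusp) :
    D.actPerm CG hS n x = D.actFun hS n x := rfl

/-- **G-L5t4g3-3 (ii): the DERIVED cusp action of the full normaliser `N_{Π_{C_F}}(Π_{X̲_K})`** on the cusps of `X̲_K`
(the action of `Aut(𝒟^{⊚±})` on `LabCusp^±(𝒟^{⊚±})`, [IUTchI] Def 6.1 (v)(vi)). ([IUTchI] Def 6.1 (v) p.158) [claim: Mochizuki2012, status: disputed] -/
def actF : ↥(Subgroup.normalizer ((D.PiXund : Subgroup D.PiC) : Set D.PiC)) →* Equiv.Perm D.geom.pe.Cusp where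
  toFun := D.actPerm CG hS
  map_one' := by
    ext x
    exact D.actFun_one CG hS x
  map_mul' n m := by
    ext x
    exact D.actFun_mul CG hS n m x

/-- `actF n x = actFun n x`. ([IUTchI] Def 6.1 (v) p.158) [claim: Mochizuki2012, status: disputed] -/
@[simp] theorem actF_apply (n : ↥(Subgroup.normalizer ((D.PiXund : Subgroup D.PiC) : Set D.PiC))) (x : D.geom.pe.Cusp) :
    D.actF CG hS n x = D.actFun hS n x := rfl

/-- **Law (a) `actF_decomp`**: `(t n)·embK(D_x)·(t n)⁻¹ = embK(D_{n·x})` for some `t ∈ Π_{X̲_K}`.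
([IUTchI] Def 6.1 (v) p.158) [claim: Mochizuki2012, status: disputed] -/
theorem actF_decomp (n : ↥(Subgroup.normalizer ((D.PiXund : Subgroup D.PiC) : Set D.PiC))) (x : D.geom.pe.Cusp) :
    ∃ t ∈ D.PiXund, MulAut.conj (t * (n : D.PiC)) • ((D.geom.pe.decomp x).map D.geom.embK) =
      (D.geom.pe.decomp (D.actF CG hS n x)).map D.geom.embK :=
  D.actFun_spec hS n x

/-- `actF` is characterised by law (a): any `y` with `(t n)·[D_x] = [D_y]`, `t ∈ Π_{X̲_K}`, equals `actF n x`.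
([IUTchI] Def 6.1 (v) p.158) [claim: Mochizuki2012, status: disputed] -/
theorem actF_eq_of_conj (n : ↥(Subgroup.normalizer ((D.PiXund : Subgroup D.PiC) : Set D.PiC))) (x y : D.geom.pe.Cusp)
    {t : D.PiC} (ht : t ∈ D.PiXund)
    (h : MulAut.conj (t * (n : D.PiC)) • ((D.geom.pe.decomp x).map D.geom.embK) = (D.geom.pe.decomp y).map D.geom.embK) :
    D.actF CG hS n x = y :=
  D.actFun_unique CG hS n x y ht h

/-- **Law (b) `actF_embK`**: on (normalising) elements of `Π_{C_K} = embK(Π_C)` the derived action IS t1's `CG.act`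
(from `CG.act_decomp`, pushed along `embK`). ([IUTchI] Def 6.1 (v) p.158) [claim: Mochizuki2012, status: disputed] -/
theorem actF_embK (c : D.geom.pe.PiC)
    (hn : D.geom.embK c ∈ Subgroup.normalizer ((D.PiXund : Subgroup D.PiC) : Set D.PiC)) :
    D.actF CG hS ⟨D.geom.embK c, hn⟩ = CG.act c := by
  ext x
  obtain ⟨t', ht', h⟩ := CG.act_decomp c x
  refine D.actF_eq_of_conj CG hS _ x _ (Subgroup.mem_map_of_mem D.geom.embK ht') ?_
  rw [Subgroup.coe_mk, ← map_mul, conj_embK_smul_map, h]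

/-- **Law (c)**: elements of `Π_{X̲_K}` act trivially — `actF` factors through `Aut(𝒟^{⊚±}) = N(Π_{X̲_K})/Π_{X̲_K}`.
([IUTchI] Def 6.1 (v) p.158) [claim: Mochizuki2012, status: disputed] -/
theorem actF_eq_one_of_mem_PiXund (n : ↥(Subgroup.normalizer ((D.PiXund : Subgroup D.PiC) : Set D.PiC)))
    (hn : (n : D.PiC) ∈ D.PiXund) : D.actF CG hS n = 1 := by
  ext x
  refine D.actF_eq_of_conj CG hS n x x (D.PiXund.inv_mem hn) ?_
  rw [inv_mul_cancel, map_one, one_smul]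

/-- If `n, m` induce the same automorphism of `𝒟^{⊚±}` (`n⁻¹m ∈ Π_{X̲_K}`) they act identically on the cusps.
([IUTchI] Def 6.1 (v) p.158) [claim: Mochizuki2012, status: disputed] -/
theorem actF_eq_of_inv_mul_mem (n m : ↥(Subgroup.normalizer ((D.PiXund : Subgroup D.PiC) : Set D.PiC)))
    (h : (n : D.PiC)⁻¹ * m ∈ D.PiXund) : D.actF CG hS n = D.actF CG hS m := by
  have hnm : m = n * (n⁻¹ * m) := by group
  rw [hnm, map_mul, D.actF_eq_one_of_mem_PiXund CG hS (n⁻¹ * m) h, mul_one]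

end InitialThetaData

end CuspNormaliserLaw

end Literature.IUT.HodgeTheaters
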